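import Literature.NumberTheory.Automorphic.HilbertModularGaloisRep
import Literature.NumberTheory.Automorphic.BockleHuiIrreducibleGL3Proofs
import Literature.NumberTheory.Automorphic.ClozelAlgebraicity
import HarnessLib

/-!
# Irreducibility of the Galois representations of Hilbert eigenforms — the proved skeleton of
# the printed proof (Skinner 2009, Remark p. 257): rank-two semisimplification and assembly

Topic `Literature/NumberTheory/Automorphic`; namespaces `Literature.NumberTheory.GaloisRepresentations`
(the representation-theoretic steps) and `Literature.NumberTheory.Automorphic` (the steps that
mention `π`).  Sibling PROOFS file (theorems only: no definition, no named fact, no `sorry`) of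
`HilbertModularGaloisRep.lean`, whose named fact
`Literature.NumberTheory.Automorphic.galoisRep_GL2_totallyReal_irreducible` (Ribet; Skinner 2009,
§2.4.2 and the Remark following it; Taylor 1995, Prop. 1.5) is NOT discharged here: its printed
proof rests on inputs that are theories of their own (below).  This file proves, sorry-free, the
steps of the printed proof that are elementary, shows that the fact is equivalent to its
restriction to semisimple `r`, and assembles the fact from the remaining printed inputs stated
as explicit hypotheses (no new named fact, D-0026), so that their Lean phrasing is fixed — the
`GL₂` counterpart of `BockleHuiIrreducibleGL3Proofs.lean`.

Source (held text `paper:doi-10-4171-dm-272`, p. 257 = p0015 of the materialised pages):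

> "As the latter representation [`ρ_{π_x}`] is irreducible (this irreducibility is well-known,
> but see also the remark below) …"
> **Remark.** "We recall that there is a quick proof of the irreducibility of `ρ_π` using that
> it is potentially semistable (really only that it is Hodge–Tate), which was established in
> 2.4.1. If `ρ_π ≅ χ₁ ⊕ χ₂`, then each `χ_i` is potentially semistable and hence is the Galois
> representation associated to an algebraic Hecke character `ψ_i` of `F` (cf. [Se], esp. III,
> 2.3–2.4). It then follows that `L(π ⊗ ψ₂⁻¹, s − 1/2) = L(ψ₁/ψ₂, s) ζ_F(s)`. As
> `ψ_i = ψ'_i |·|^{a_i}` with `a_i ∈ ℤ` and `ψ'_i` finite and since we may assume `a₁ ≥ a₂`,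
> `L(ψ₁/ψ₂, 1) ≠ 0`. But this implies that `L(π ⊗ ψ₂⁻¹, s)` has a pole at `s = 1`,
> contradicting the cuspidality of `π`."

## What is proved here

* `exists_subrepresentation_finrank_eq_one_of_not_isIrreducible_two` — a two-dimensional
  representation over a field which is not irreducible (Mathlib `Representation.IsIrreducible`)
  has a one-dimensional subrepresentation (no semisimplicity needed in rank two).
* `FramedRep.charpoly_eq_of_eigenvector_two`, `FramedRep.exists_rankOne_pair_of_not_isIrreducible`
  — "`ρ_π ≅ χ₁ ⊕ χ₂`" in the framed language of the tree, for an `r : G →ₜ* GL₂(A)` that is NOT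
  assumed semisimple: the character `τ₁` of a stable line and the quotient character
  `τ₂ = det r / τ₁` are continuous, and `charpoly r(g) = (X - τ₁ g)(X - τ₂ g)`.
* `FramedRep.exists_diagonal_two`, `FramedRep.isSemisimpleRepresentation_of_diagonal_two`,
  `FramedRep.not_isIrreducible_of_diagonal_two`, `FramedRep.charpoly_of_diagonal_two`,
  `FramedRep.apply_single_of_diagonal_two` — the direct sum `τ₁ ⊕ τ₂` as a framed rank-two
  representation: semisimple (Mathlib `Representation.IsSemisimpleRepresentation`, by an explicit
  complement for every subrepresentation), not irreducible, with the expected characteristic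
  polynomials and eigenvectors.
* `FramedGaloisRep.exists_semisimplification_two` — the semisimplification `r^{ss} = τ₁ ⊕ τ₂` of
  a reducible `r : Γ_K →ₜ* GL₂(A)`: semisimple, reducible, same Frobenius characteristic
  polynomials, unramified wherever `r` is.
* `exists_semisimple_compatible_of_not_isIrreducible` — for `r` compatible with `π`
  (`IsGaloisCompatibleAt` at every `v ∤ ℓ`) and reducible: `r^{ss}` is compatible, and at every
  good place `{τ₁(Frob_v), τ₂(Frob_v)} = {ι⁻¹((√q_v a)⁻¹) : a ∈ α_v}`.
* `galoisRep_GL2_totallyReal_irreducible_of_semisimple`, `…_iff_semisimple`,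
  `…_iff_satakeCompatible` — THE FACT IS EQUIVALENT TO ITS RESTRICTION TO SEMISIMPLE `r` (the
  "Rendering" paragraph of `HilbertModularGaloisRep`, proved), and to the `n = 2` analogue of the
  phrasing of `isIrreducible_galoisRep_gl3_totallyReal` / route `ReducibleSelfDual`.
* `galoisRep_GL2_totallyReal_irreducible_of_abelianSummandIsHecke_of_not_eisenstein` — the fact
  from the two printed inputs as hypotheses: the dictionary "characters of `ρ_π^{ss}` are
  algebraic Hecke characters" (in print: Hodge–Tate + Serre III §2.3–2.4; in the tree: the `n = 2`
  totally real case of the route item `AbelianSummandIsHecke`) and the analytic half "a cuspidal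
  `π` on `GL₂` is not nearly equivalent to `χ₁|·|^{1/2} ⊞ χ₂|·|^{1/2}`" (the pole of
  `L(ψ₁/ψ₂, s) ζ_F(s)`; Jacquet–Shalika 1981 II, Thm. 4.4), rendered at Satake level.
* `abelianSummandIsHecke_GL2_totallyReal_of_weaklyDivides_of_rational`,
  `galoisRep_GL2_totallyReal_irreducible_of_weaklyDivides_of_rational_of_not_eisenstein` — the
  dictionary from the in-tree named fact `GaloisRepresentations.exists_heckeCharacter_of_weaklyDivides`
  (Böckle–Hui 2025, Thm. 1.1) and the `E`-rationality of compatible `r` (Shimura / Clozel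
  Thm. 3.13), via `GaloisRepresentations.exists_heckeCharacter_of_stableLine`.
* `isRationalOver_of_heckeEigenvalue_mem_two`, `rational_GL2_totallyReal_of_heckeEigenvalue_mem`,
  `galoisRep_GL2_totallyReal_irreducible_of_weaklyDivides_of_heckeEigenvalue_mem_of_not_eisenstein`
  — the `E`-rationality of compatible `r` (Böckle–Hui §3.1, the passage "Satake parameters of
  `π_v ⊗ |det|^{-1/2}` defined over `E` ⇒ `ρ_{π,ι}` is `E`-rational", which
  `BockleHuiIrreducibleGL3Proofs` lists as "not in the tree") PROVED in rank two from the
  rationality of the unramified Hecke eigenvalues `heckeEigenvalueOf 2 v α i ∈ E`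
  (`ClozelAlgebraicity`), so that the dictionary input rests on Böckle–Hui Thm. 1.1 and the
  printed statement "the Hecke eigenvalues of `π` lie in a number field" alone.

## Status of the printed inputs in the tree (why the fact is not discharged)

* Hodge–Tate property of `ρ_π` at `v ∣ ℓ` (Skinner Thm. 1; Blasius–Rogawski; Saito) and the
  Tate–Sen / Serre Ch. III dictionary "Hodge–Tate abelian ⇒ algebraic Hecke character": absent.
  The tree's substitute, Böckle–Hui Thm. 1.1 (`exists_heckeCharacter_of_weaklyDivides`), is an
  unproved named fact (Serre–Waldschmidt–Henniart transcendence), and its `E`-rationality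
  hypothesis (algebraicity of the Hecke eigenvalues of Hilbert eigenforms, Shimura 1978; Clozel
  1990, Thm. 3.13) has no named fact (`ClozelAlgebraicityRatFieldProofs`: "the algebraicity of
  the eigenvalues themselves is the deep input not proved here").
* The analytic half lives in the tree only in the `L²` model and as named facts
  (`JacquetShalika1981_partialPairL_*` of `PairLFunctionPoles`, the bridges `exists_isAssociatedL2`,
  `hasSatakeParamAt_iff_L2`), not for the Borel–Jacquet datum `π` used here.
The `K = ℚ` analogue (Ribet 1977, Thm. (2.3)) is in the same state
(`EllipticCurves/NewformGaloisRepRibetReducible.lean`, review of 2026-08-15: "irreducibly XL").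

## References

* C. Skinner, *A note on the `p`-adic Galois representations attached to Hilbert modular forms*,
  Doc. Math. 14 (2009) 241–258, §2.4.2 and the Remark, p. 257. [Skinner2009]
* R. Taylor, *On Galois representations associated to Hilbert modular forms II* (1995),
  Thm. 1.1, Prop. 1.5. [Taylor1995HMFII]
* G. Böckle, C.-Y. Hui, *Weak abelian direct summands and irreducibility of Galois
  representations*, Math. Ann. 393 (2025), Thm. 1.1, §3.2.1. [BockleHui2025]
* H. Jacquet, J. Shalika, *On Euler products and the classification of automorphic forms II*,
  Amer. J. Math. 103 (1981), Thm. 4.4. [JacquetShalikaAJM1981II]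
* J.-P. Serre, *Abelian ℓ-adic representations and elliptic curves* (1968), Ch. III §2.3–2.4.
  [SerreAbelianLadic1968]
-/

noncomputable section

open scoped NumberField Matrix Polynomial Classical
open NumberField IsDedekindDomain Field Polynomial Filter

namespace Literature.NumberTheory.GaloisRepresentations

/-! ### A reducible plane representation has a stable line (no semisimplicity needed) -/

section StableLine

variable {A G V : Type*} [Field A] [Group G] [AddCommGroup V] [Module A V] [FiniteDimensional A V]

/-- **A reducible two-dimensional representation has a one-dimensional subrepresentation.**
If `dim V = 2` and `ρ` is not irreducible, some subrepresentation `W ≠ ⊥, ⊤` exists, and its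
dimension is `1`.  (First sentence of the printed proof: "If `ρ_π ≅ χ₁ ⊕ χ₂` …", i.e. a
reducible plane representation is an extension of a character by a character.) [folklore] -/
theorem exists_subrepresentation_finrank_eq_one_of_not_isIrreducible_two (ρ : Representation A G V)
    (h2 : Module.finrank A V = 2) (hirr : ¬ ρ.IsIrreducible) :
    ∃ W : Subrepresentation ρ, Module.finrank A W.toSubmodule = 1 := by
  classical
  have hbot : (⊥ : Subrepresentation ρ).toSubmodule = ⊥ := rfl
  have htop : (⊤ : Subrepresentation ρ).toSubmodule = ⊤ := rfl
  haveI hnt : Nontrivial (Subrepresentation ρ) := by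
    refine ⟨⟨⊥, ⊤, fun h => ?_⟩⟩
    have h0 : Module.finrank A (⊥ : Submodule A V) = Module.finrank A (⊤ : Submodule A V) := by
      rw [← hbot, ← htop, h]
    rw [finrank_bot, finrank_top, h2] at h0
    exact absurd h0 (by norm_num)
  obtain ⟨W, hWb, hWt⟩ : ∃ W : Subrepresentation ρ, W ≠ ⊥ ∧ W ≠ ⊤ := by
    by_contra hcon
    push Not at hcon
    exact hirr { eq_bot_or_eq_top := fun W => (eq_or_ne W ⊥).imp_right (hcon W) }
  have hWb' : W.toSubmodule ≠ ⊥ := fun h =>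
    hWb (Subrepresentation.toSubmodule_injective (h.trans hbot.symm))
  have hWt' : W.toSubmodule ≠ ⊤ := fun h =>
    hWt (Subrepresentation.toSubmodule_injective (h.trans htop.symm))
  have h1 : Module.finrank A W.toSubmodule ≠ 0 := fun h => hWb' (Submodule.finrank_eq_zero.1 h)
  have h3 : Module.finrank A W.toSubmodule < 2 := h2 ▸ Submodule.finrank_lt hWt'
  exact ⟨W, by omega⟩

omit [FiniteDimensional A V] in
/-- Complements of subrepresentations may be checked on the underlying submodules. [folklore] -/
theorem Subrepresentation.isCompl_of_toSubmodule {ρ : Representation A G V}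
    {W W' : Subrepresentation ρ} (h : IsCompl W.toSubmodule W'.toSubmodule) : IsCompl W W' := by
  refine ⟨disjoint_iff.2 (Subrepresentation.toSubmodule_injective ?_),
    codisjoint_iff.2 (Subrepresentation.toSubmodule_injective ?_)⟩
  · rw [Subrepresentation.toSubmodule_inf]
    exact h.inf_eq_bot
  · rw [Subrepresentation.toSubmodule_sup]
    exact h.sup_eq_top

end StableLine

/-! ### Rank-two framed representations: the two characters of a reducible one -/

section RankTwo

variable {G : Type*} [Group G] [TopologicalSpace G] [IsTopologicalGroup G]
  {A : Type*} [Field A] [TopologicalSpace A] [IsTopologicalRing A]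

omit [IsTopologicalGroup G] [IsTopologicalRing A] in
/-- **Characteristic polynomial of an invertible `2 × 2` matrix with a given eigenvalue.**  If
`x ≠ 0` and `r(g) x = d • x` then `d ≠ 0` and `charpoly r(g) = (X - d)(X - det r(g) / d)`
(`d` is a root of `X² - tr X + det`, Mathlib `Matrix.charpoly_fin_two`). [folklore] -/
theorem FramedRep.charpoly_eq_of_eigenvector_two (r : FramedRep G A 2) {x : Fin 2 → A}
    (hx0 : x ≠ 0) {g : G} {d : A} (hd : r.toRepresentation g x = d • x) :
    d ≠ 0 ∧ FramedRep.charpoly r g =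
      (X - C d) * (X - C (((Matrix.GeneralLinearGroup.det (r g) : Aˣ) : A) * d⁻¹)) := by
  set M : Matrix (Fin 2) (Fin 2) A := ((r g : GL (Fin 2) A) : Matrix (Fin 2) (Fin 2) A) with hM
  have hmul : M *ᵥ x = d • x := by simpa using hd
  -- `d ≠ 0`: `M` is invertible and `x ≠ 0`
  have hd0 : d ≠ 0 := by
    intro h0
    rw [h0, zero_smul] at hmul
    apply hx0
    have : ((r g)⁻¹ : GL (Fin 2) A) *ᵥ (M *ᵥ x) = x := by
      rw [Matrix.mulVec_mulVec, hM, ← Units.val_mul, inv_mul_cancel, Units.val_one, Matrix.one_mulVec]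
    rw [← this, hmul, Matrix.mulVec_zero]
  -- `d` is a root of the characteristic polynomial
  have hroot : (FramedRep.charpoly r g).IsRoot d := by
    rw [IsRoot.def, FramedRep.charpoly, Matrix.eval_charpoly, ← Matrix.exists_mulVec_eq_zero_iff]
    refine ⟨x, hx0, ?_⟩
    rw [Matrix.sub_mulVec, ← hM, hmul]
    ext j
    simp [Matrix.scalar_apply]
  have hdet : ((Matrix.GeneralLinearGroup.det (r g) : Aˣ) : A) = M.det := by
    rw [Matrix.GeneralLinearGroup.val_det_apply]
  rw [FramedRep.charpoly, ← hM, Matrix.charpoly_fin_two, IsRoot.def] at hroot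
  simp only [eval_add, eval_sub, eval_mul, eval_pow, eval_C, eval_X] at hroot
  have htr : M.trace = d + M.det * d⁻¹ := by
    have h1 : M.trace * d = d ^ 2 + M.det := by linear_combination (-1 : A) * hroot
    calc M.trace = M.trace * d * d⁻¹ := by rw [mul_inv_cancel_right₀ hd0]
      _ = (d ^ 2 + M.det) * d⁻¹ := by rw [h1]
      _ = d + M.det * d⁻¹ := by rw [add_mul, pow_two, mul_inv_cancel_right₀ hd0]
  refine ⟨hd0, ?_⟩
  rw [FramedRep.charpoly, ← hM, Matrix.charpoly_fin_two, htr, hdet]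
  have hdd : (d * (M.det * d⁻¹) : A) = M.det := by
    rw [mul_comm, mul_assoc, inv_mul_cancel₀ hd0, mul_one]
  calc X ^ 2 - C (d + M.det * d⁻¹) * X + C M.det
      = X ^ 2 - C (d + M.det * d⁻¹) * X + C (d * (M.det * d⁻¹)) := by rw [hdd]
    _ = (X - C d) * (X - C (M.det * d⁻¹)) := by
        simp only [map_add, map_mul]
        ring

/-- **The two characters of a reducible rank-two framed representation.**  If the continuous
representation `r : G →ₜ* GL₂(A)` (`A` a topological field) is not irreducible, there are
continuous characters `τ₁, τ₂ : G →ₜ* GL₁(A)` — `τ₁` the character of an `r`-stable line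
`A x`, `τ₂ = det r / τ₁` the character of the quotient — with
`charpoly r(g) = (X - τ₁(g))(X - τ₂(g))` for every `g`; i.e. `r` is an extension of `τ₂` by `τ₁`
and `r^{ss} ≅ τ₁ ⊕ τ₂` ("If `ρ_π ≅ χ₁ ⊕ χ₂` …").  No semisimplicity of `r` is assumed.
[folklore] -/
theorem FramedRep.exists_rankOne_pair_of_not_isIrreducible (r : FramedRep G A 2)
    (hirr : ¬ (FramedRep.toRepresentation r).IsIrreducible) :
    ∃ (τ₁ τ₂ : FramedRep G A 1) (x : Fin 2 → A), x ≠ 0 ∧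
      (∀ g : G, r.toRepresentation g x =
        ((Matrix.GeneralLinearGroup.det (τ₁ g) : Aˣ) : A) • x) ∧
      (∀ g : G, ((Matrix.GeneralLinearGroup.det (r g) : Aˣ) : A) =
        ((Matrix.GeneralLinearGroup.det (τ₁ g) : Aˣ) : A) *
          ((Matrix.GeneralLinearGroup.det (τ₂ g) : Aˣ) : A)) ∧
      ∀ g : G, FramedRep.charpoly r g =
        (X - C ((Matrix.GeneralLinearGroup.det (τ₁ g) : Aˣ) : A)) *
          (X - C ((Matrix.GeneralLinearGroup.det (τ₂ g) : Aˣ) : A)) := by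
  have h2 : Module.finrank A (Fin 2 → A) = 2 := Module.finrank_fin_fun A
  obtain ⟨W, hW⟩ := exists_subrepresentation_finrank_eq_one_of_not_isIrreducible_two
    (FramedRep.toRepresentation r) h2 hirr
  obtain ⟨x, hx0, hx⟩ := exists_stableLine_of_finrank_eq_one _ hW
  obtain ⟨τ₁, hτ₁⟩ := FramedRep.exists_rankOne_of_stableLine r hx0 hx
  -- the complementary character `det r / det τ₁`
  let χ₂ : G →ₜ* Aˣ :=
    { toFun := fun g =>
        Matrix.GeneralLinearGroup.det (r g) * (Matrix.GeneralLinearGroup.det (τ₁ g))⁻¹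
      map_one' := by simp
      map_mul' := fun g h => by
        simp only [map_mul, mul_inv]
        exact mul_mul_mul_comm _ _ _ _
      continuous_toFun :=
        (map_continuous (FramedRep.det r)).mul (map_continuous (FramedRep.det τ₁)).inv }
  have hχ₂ : ∀ g, χ₂ g =
      Matrix.GeneralLinearGroup.det (r g) * (Matrix.GeneralLinearGroup.det (τ₁ g))⁻¹ := fun _ => rfl
  let τ₂ : FramedRep G A 1 :=
    (FramedRep.unitsContinuousMulEquivOfUnique (Fin 1) A : Aˣ →ₜ* GL (Fin 1) A).comp χ₂
  have hτ₂ : ∀ g, Matrix.GeneralLinearGroup.det (τ₂ g) = χ₂ g := fun g => by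
    refine Units.ext ?_
    rw [Matrix.GeneralLinearGroup.val_det_apply, Matrix.det_unique]
    rfl
  refine ⟨τ₁, τ₂, x, hx0, hτ₁, fun g => ?_, fun g => ?_⟩
  · rw [hτ₂, hχ₂, ← Units.val_mul, mul_comm, inv_mul_cancel_right]
  · obtain ⟨hd0, hchar⟩ := FramedRep.charpoly_eq_of_eigenvector_two r hx0 (hτ₁ g)
    rw [hchar, hτ₂, hχ₂, Units.val_mul, Units.val_inv_eq_inv_val]

/-! ### Rank-two framed representations: the diagonal representation `χ₁ ⊕ χ₂` -/

omit [IsTopologicalRing A] in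
/-- **The direct sum of two continuous characters as a framed rank-two representation**:
`g ↦ diag(χ₁ g, χ₂ g)` is a continuous homomorphism `G →ₜ* GL₂(A)`. [folklore] -/
theorem FramedRep.exists_diagonal_two (χ₁ χ₂ : G →ₜ* Aˣ) :
    ∃ s : FramedRep G A 2, ∀ g : G,
      ((s g : GL (Fin 2) A) : Matrix (Fin 2) (Fin 2) A) = Matrix.diagonal ![(χ₁ g : A), (χ₂ g : A)] := by
  let d : G → Fin 2 → A := fun g => ![(χ₁ g : A), (χ₂ g : A)]
  have hd1 : d 1 = 1 := by
    ext i; fin_cases i <;> simp [d]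
  have hdmul : ∀ g h, d (g * h) = d g * d h := fun g h => by
    ext i; fin_cases i <;> simp [d]
  have hdc : Continuous d := continuous_pi fun i => by
    fin_cases i
    · simp only [d]
      exact Units.continuous_val.comp (map_continuous χ₁)
    · simp only [d]
      exact Units.continuous_val.comp (map_continuous χ₂)
  let u : G → GL (Fin 2) A := fun g =>
    { val := Matrix.diagonal (d g)
      inv := Matrix.diagonal (d g⁻¹)
      val_inv := by
        rw [Matrix.diagonal_mul_diagonal, ← Pi.mul_def, ← hdmul, mul_inv_cancel, hd1]
        exact Matrix.diagonal_one
      inv_val := by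
        rw [Matrix.diagonal_mul_diagonal, ← Pi.mul_def, ← hdmul, inv_mul_cancel, hd1]
        exact Matrix.diagonal_one }
  refine ⟨{ toFun := u
            map_one' := Units.ext (by simp [u, hd1])
            map_mul' := fun g h => Units.ext ?_
            continuous_toFun := ?_ }, fun g => rfl⟩
  · change Matrix.diagonal (d (g * h)) = Matrix.diagonal (d g) * Matrix.diagonal (d h)
    rw [Matrix.diagonal_mul_diagonal, hdmul]
    rfl
  · refine Units.continuous_iff.2 ⟨?_, ?_⟩
    · exact hdc.matrix_diagonal
    · change Continuous fun g => Matrix.diagonal (d g⁻¹)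
      exact (hdc.comp continuous_inv).matrix_diagonal

omit [IsTopologicalGroup G] [IsTopologicalRing A] in
/-- **A diagonal rank-two representation is semisimple** (Mathlib
`Representation.IsSemisimpleRepresentation`: every subrepresentation has a complement).  If
every `r(g)` is diagonal, the coordinate axes are stable lines; a stable line `A x` has the
stable complement `{v | v i = 0}` for any `i` with `x i ≠ 0`, and `⊥`, `⊤` complement each
other. [folklore] -/
theorem FramedRep.isSemisimpleRepresentation_of_diagonal_two (s : FramedRep G A 2)
    (d : G → Fin 2 → A)
    (hs : ∀ g : G, ((s g : GL (Fin 2) A) : Matrix (Fin 2) (Fin 2) A) = Matrix.diagonal (d g)) :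
    (FramedRep.toRepresentation s).IsSemisimpleRepresentation := by
  classical
  set ρ := FramedRep.toRepresentation s with hρ
  have h2 : Module.finrank A (Fin 2 → A) = 2 := Module.finrank_fin_fun A
  have hact : ∀ (g : G) (v : Fin 2 → A) (i : Fin 2), ρ g v i = d g i * v i := by
    intro g v i
    rw [hρ, FramedRep.toRepresentation_apply_apply, hs, Matrix.mulVec_diagonal]
  -- the coordinate hyperplanes (= axes) are subrepresentations
  let L : Fin 2 → Subrepresentation ρ := fun i =>
    { toSubmodule := LinearMap.ker (LinearMap.proj i : (Fin 2 → A) →ₗ[A] A)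
      apply_mem_toSubmodule := fun g v hv => by
        simp only [LinearMap.mem_ker, LinearMap.proj_apply] at hv ⊢
        rw [hact, hv, mul_zero] }
  have hLmem : ∀ (i : Fin 2) (v : Fin 2 → A), v ∈ (L i).toSubmodule ↔ v i = 0 := fun i v => by
    simp [L]
  have hLrank : ∀ i : Fin 2, Module.finrank A (L i).toSubmodule = 1 := fun i => by
    have h := LinearMap.finrank_range_add_finrank_ker (LinearMap.proj i : (Fin 2 → A) →ₗ[A] A)
    rw [LinearMap.range_eq_top.2 (LinearMap.proj_surjective i), finrank_top, Module.finrank_self,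
      h2] at h
    change Module.finrank A (LinearMap.ker (LinearMap.proj i : (Fin 2 → A) →ₗ[A] A)) = 1
    omega
  have hbot : (⊥ : Subrepresentation ρ).toSubmodule = ⊥ := rfl
  have htop : (⊤ : Subrepresentation ρ).toSubmodule = ⊤ := rfl
  refine ⟨fun W => ?_⟩
  have hle : Module.finrank A W.toSubmodule ≤ 2 := by
    have h := Submodule.finrank_le W.toSubmodule
    rwa [h2] at h
  rcases Nat.lt_or_ge (Module.finrank A W.toSubmodule) 1 with h0 | h1
  · -- `W = ⊥`
    have hW : W = ⊥ := Subrepresentation.toSubmodule_injective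
      ((Submodule.finrank_eq_zero.1 (by omega)).trans hbot.symm)
    exact ⟨⊤, hW ▸ isCompl_bot_top⟩
  rcases Nat.lt_or_ge (Module.finrank A W.toSubmodule) 2 with h1' | h2'
  · -- `W` is a line `A x`
    have hW1 : Module.finrank A W.toSubmodule = 1 := by omega
    obtain ⟨v, hv0, hv⟩ := finrank_eq_one_iff'.1 hW1
    set x : Fin 2 → A := (v : Fin 2 → A) with hx
    have hx0 : x ≠ 0 := fun h => hv0 (Subtype.ext h)
    obtain ⟨i, hi⟩ : ∃ i, x i ≠ 0 := Function.ne_iff.mp hx0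
    refine ⟨L i, Subrepresentation.isCompl_of_toSubmodule ?_⟩
    -- disjointness
    have hdisj : W.toSubmodule ⊓ (L i).toSubmodule = ⊥ := by
      rw [eq_bot_iff]
      intro w hw
      obtain ⟨hwW, hwL⟩ := Submodule.mem_inf.1 hw
      obtain ⟨c, hc⟩ := hv ⟨w, hwW⟩
      have hcw : c • x = w := by simpa [hx] using congrArg Subtype.val hc
      have hwi : w i = 0 := (hLmem i w).1 hwL
      have hc0 : c = 0 := by
        have : c * x i = 0 := by
          have := congrFun hcw i
          rw [Pi.smul_apply, smul_eq_mul] at this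
          rw [this, hwi]
        exact (mul_eq_zero.1 this).resolve_right hi
      rw [Submodule.mem_bot, ← hcw, hc0, zero_smul]
    refine IsCompl.of_eq hdisj ?_
    -- codisjointness by dimension count
    haveI : FiniteDimensional A W.toSubmodule := inferInstance
    have hsum := Submodule.finrank_sup_add_finrank_inf_eq W.toSubmodule (L i).toSubmodule
    rw [hdisj, finrank_bot, hW1, hLrank i] at hsum
    exact Submodule.eq_top_of_finrank_eq (by rw [h2]; omega)
  · -- `W = ⊤`
    have hW : W = ⊤ := Subrepresentation.toSubmodule_injective
      ((Submodule.eq_top_of_finrank_eq (by rw [h2]; omega)).trans htop.symm)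
    exact ⟨⊥, hW ▸ isCompl_top_bot⟩

omit [IsTopologicalGroup G] [IsTopologicalRing A] in
/-- **A diagonal rank-two representation is not irreducible**: the axis `{v | v 1 = 0}` is a
subrepresentation different from `⊥` and `⊤`. [folklore] -/
theorem FramedRep.not_isIrreducible_of_diagonal_two (s : FramedRep G A 2) (d : G → Fin 2 → A)
    (hs : ∀ g : G, ((s g : GL (Fin 2) A) : Matrix (Fin 2) (Fin 2) A) = Matrix.diagonal (d g)) :
    ¬ (FramedRep.toRepresentation s).IsIrreducible := by
  classical
  intro hirr
  set ρ := FramedRep.toRepresentation s with hρ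
  have hact : ∀ (g : G) (v : Fin 2 → A) (i : Fin 2), ρ g v i = d g i * v i := by
    intro g v i
    rw [hρ, FramedRep.toRepresentation_apply_apply, hs, Matrix.mulVec_diagonal]
  let L : Subrepresentation ρ :=
    { toSubmodule := LinearMap.ker (LinearMap.proj 1 : (Fin 2 → A) →ₗ[A] A)
      apply_mem_toSubmodule := fun g v hv => by
        simp only [LinearMap.mem_ker, LinearMap.proj_apply] at hv ⊢
        rw [hact, hv, mul_zero] }
  have hmem : ∀ v : Fin 2 → A, v ∈ L.toSubmodule ↔ v 1 = 0 := fun v => by simp [L]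
  rcases hirr.eq_bot_or_eq_top L with h | h
  · have h0 : (Pi.single (0 : Fin 2) (1 : A) : Fin 2 → A) ∈ L.toSubmodule :=
      (hmem (Pi.single (0 : Fin 2) (1 : A))).2 (by simp)
    rw [h] at h0
    change (Pi.single (0 : Fin 2) (1 : A) : Fin 2 → A) ∈ (⊥ : Submodule A (Fin 2 → A)) at h0
    rw [Submodule.mem_bot] at h0
    have h00 := congrFun h0 0
    simp only [Pi.single_eq_same, Pi.zero_apply] at h00
    exact one_ne_zero h00
  · have h1 : (Pi.single (1 : Fin 2) (1 : A) : Fin 2 → A) ∈ L.toSubmodule := by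
      rw [h]
      change (Pi.single (1 : Fin 2) (1 : A) : Fin 2 → A) ∈ (⊤ : Submodule A (Fin 2 → A))
      exact Submodule.mem_top
    rw [hmem] at h1
    simp only [Pi.single_eq_same] at h1
    exact one_ne_zero h1

omit [IsTopologicalGroup G] [IsTopologicalRing A] in
/-- Characteristic polynomial of a diagonal rank-two representation:
`charpoly diag(d₀, d₁) = (X - d₀)(X - d₁)` (Mathlib `Matrix.charpoly_diagonal`). [folklore] -/
theorem FramedRep.charpoly_of_diagonal_two (s : FramedRep G A 2) (d : G → Fin 2 → A)
    (hs : ∀ g : G, ((s g : GL (Fin 2) A) : Matrix (Fin 2) (Fin 2) A) = Matrix.diagonal (d g))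
    (g : G) : FramedRep.charpoly s g = (X - C (d g 0)) * (X - C (d g 1)) := by
  rw [FramedRep.charpoly, hs, Matrix.charpoly_diagonal, Fin.prod_univ_two]

omit [IsTopologicalGroup G] [IsTopologicalRing A] in
/-- The action of a diagonal rank-two representation on the coordinate vectors:
`s(g) e_i = d_i(g) • e_i`. [folklore] -/
theorem FramedRep.apply_single_of_diagonal_two (s : FramedRep G A 2) (d : G → Fin 2 → A)
    (hs : ∀ g : G, ((s g : GL (Fin 2) A) : Matrix (Fin 2) (Fin 2) A) = Matrix.diagonal (d g))
    (g : G) (i : Fin 2) :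
    s.toRepresentation g (Pi.single i 1) = d g i • (Pi.single i 1 : Fin 2 → A) := by
  ext j
  rw [FramedRep.toRepresentation_apply_apply, hs, Matrix.mulVec_diagonal, Pi.smul_apply,
    smul_eq_mul]
  by_cases hij : j = i
  · subst hij; simp
  · simp [Pi.single_eq_of_ne hij]

end RankTwo

/-! ### Rank one: a `GL₁` element with determinant one is trivial -/

section RankOne

variable {A : Type*} [CommRing A]

/-- An element of `GL₁(A)` with determinant `1` is `1`. [folklore] -/
theorem glFinOne_eq_one_of_det_eq_one {u : GL (Fin 1) A}
    (h : ((Matrix.GeneralLinearGroup.det u : Aˣ) : A) = 1) : u = 1 := by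
  refine Units.ext (Matrix.ext fun i j => ?_)
  have hdet : ((u : GL (Fin 1) A) : Matrix (Fin 1) (Fin 1) A).det = 1 := by
    rw [← Matrix.GeneralLinearGroup.val_det_apply, h]
  rw [Matrix.det_fin_one] at hdet
  rw [Subsingleton.elim i 0, Subsingleton.elim j 0, hdet]
  simp

end RankOne

/-! ### Galois representations of rank two: semisimplification of a reducible one -/

section Galois

variable {K : Type*} [Field K] {A : Type*} [Field A] [TopologicalSpace A] [IsTopologicalRing A]

/-- **Semisimplification of a reducible rank-two Galois representation, in the framed language
of the tree.**  Let `r : Γ_K →ₜ* GL₂(A)` be continuous and NOT irreducible.  Then there are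
continuous characters `τ₁, τ₂ : Γ_K →ₜ* GL₁(A)` (`τ₁` on an `r`-stable line `A x`,
`τ₂ = det r / τ₁`) and the continuous representation `s = τ₁ ⊕ τ₂ : Γ_K →ₜ* GL₂(A)`,
`s(g) = diag(τ₁ g, τ₂ g)` — the semisimplification `r^{ss}` — such that: `s` is semisimple and
not irreducible; `charpoly s(g) = charpoly r(g) = charpoly τ₁(g) · charpoly τ₂(g)` for every
`g`; `s`, `τ₁`, `τ₂` are unramified wherever `r` is; `s` has every Frobenius characteristic
polynomial that `r` has; and `τ₁`, `τ₂` occur on the `s`-stable coordinate lines.  This is the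
step "if `ρ_π` [is reducible then] `ρ_π^{ss} ≅ χ₁ ⊕ χ₂`" of the printed proof, and the reason
why irreducibility of every compatible `r` is equivalent to irreducibility of every SEMISIMPLE
compatible `r` (`Literature.NumberTheory.Automorphic.galoisRep_GL2_totallyReal_irreducible_iff_semisimple`).
[folklore] -/
theorem FramedGaloisRep.exists_semisimplification_two (r : FramedGaloisRep K A 2)
    (hirr : ¬ r.toGaloisRep.IsIrreducible) :
    ∃ (τ₁ τ₂ : FramedGaloisRep K A 1) (s : FramedGaloisRep K A 2) (x : Fin 2 → A), x ≠ 0 ∧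
      (∀ g, r.toGaloisRep g x = ((Matrix.GeneralLinearGroup.det (τ₁ g) : Aˣ) : A) • x) ∧
      (∀ g, ((s g : GL (Fin 2) A) : Matrix (Fin 2) (Fin 2) A) =
        Matrix.diagonal ![((Matrix.GeneralLinearGroup.det (τ₁ g) : Aˣ) : A),
          ((Matrix.GeneralLinearGroup.det (τ₂ g) : Aˣ) : A)]) ∧
      s.toGaloisRep.IsSemisimple ∧ ¬ s.toGaloisRep.IsIrreducible ∧
      (∀ g, FramedRep.charpoly s g = FramedRep.charpoly r g) ∧
      (∀ g, FramedRep.charpoly τ₁ g * FramedRep.charpoly τ₂ g = FramedRep.charpoly r g) ∧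
      (∀ v : HeightOneSpectrum (𝓞 K), r.IsUnramifiedAt v →
        s.IsUnramifiedAt v ∧ τ₁.IsUnramifiedAt v ∧ τ₂.IsUnramifiedAt v) ∧
      (∀ (v : HeightOneSpectrum (𝓞 K)) (P : Polynomial A),
        r.HasFrobCharpolyAt v P → s.HasFrobCharpolyAt v P) ∧
      (∀ g, s.toGaloisRep g (Pi.single 0 1) =
        ((Matrix.GeneralLinearGroup.det (τ₁ g) : Aˣ) : A) • (Pi.single 0 1 : Fin 2 → A)) ∧
      (∀ g, s.toGaloisRep g (Pi.single 1 1) =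
        ((Matrix.GeneralLinearGroup.det (τ₂ g) : Aˣ) : A) • (Pi.single 1 1 : Fin 2 → A)) := by
  obtain ⟨τ₁, τ₂, x, hx0, hx, hdet, hchar⟩ :=
    FramedRep.exists_rankOne_pair_of_not_isIrreducible r hirr
  obtain ⟨s, hs⟩ := FramedRep.exists_diagonal_two (FramedRep.det τ₁) (FramedRep.det τ₂)
  set d : absoluteGaloisGroup K → Fin 2 → A := fun g =>
    ![((Matrix.GeneralLinearGroup.det (τ₁ g) : Aˣ) : A),
      ((Matrix.GeneralLinearGroup.det (τ₂ g) : Aˣ) : A)] with hd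
  have hs' : ∀ g, ((s g : GL (Fin 2) A) : Matrix (Fin 2) (Fin 2) A) = Matrix.diagonal (d g) :=
    fun g => hs g
  have hd0 : ∀ g, d g 0 = ((Matrix.GeneralLinearGroup.det (τ₁ g) : Aˣ) : A) := fun g => rfl
  have hd1 : ∀ g, d g 1 = ((Matrix.GeneralLinearGroup.det (τ₂ g) : Aˣ) : A) := fun g => rfl
  have hcharS : ∀ g, FramedRep.charpoly s g = FramedRep.charpoly r g := fun g => by
    rw [FramedRep.charpoly_of_diagonal_two s d hs' g, hchar g, hd0, hd1]
  -- on inertia both characters are trivial wherever `r` is unramified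
  have hI : ∀ v : HeightOneSpectrum (𝓞 K), r.IsUnramifiedAt v → ∀ 𝔓 ∈ v.primesAbove,
      ∀ σ ∈ 𝔓.inertia (absoluteGaloisGroup K),
        ((Matrix.GeneralLinearGroup.det (τ₁ σ) : Aˣ) : A) = 1 ∧
          ((Matrix.GeneralLinearGroup.det (τ₂ σ) : Aˣ) : A) = 1 := by
    intro v hv 𝔓 h𝔓 σ hσ
    have h1 : r σ = 1 := hv 𝔓 h𝔓 σ hσ
    have e1 : ((Matrix.GeneralLinearGroup.det (τ₁ σ) : Aˣ) : A) = 1 := by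
      have h2 := hx σ
      have h3 : FramedRep.toRepresentation r σ x = x := by
        rw [FramedRep.toRepresentation_apply_apply, h1, Units.val_one, Matrix.one_mulVec]
      rw [h3] at h2
      obtain ⟨i, hi⟩ : ∃ i, x i ≠ 0 := Function.ne_iff.mp hx0
      have h4 : ((Matrix.GeneralLinearGroup.det (τ₁ σ) : Aˣ) : A) * x i = x i := by
        have := congrFun h2 i
        rw [Pi.smul_apply, smul_eq_mul] at this
        exact this.symm
      exact (mul_eq_right₀ hi).1 h4
    have e2 : ((Matrix.GeneralLinearGroup.det (τ₂ σ) : Aˣ) : A) = 1 := by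
      have := hdet σ
      rw [h1, map_one, Units.val_one, e1, one_mul] at this
      exact this.symm
    exact ⟨e1, e2⟩
  refine ⟨τ₁, τ₂, s, x, hx0, hx, hs, ?_, ?_, hcharS, ?_, ?_, ?_, ?_, ?_⟩
  · exact FramedRep.isSemisimpleRepresentation_of_diagonal_two s d hs'
  · exact FramedRep.not_isIrreducible_of_diagonal_two s d hs'
  · intro g
    rw [charpoly_eq_X_sub_C_det, charpoly_eq_X_sub_C_det, hchar g]
  · intro v hv
    refine ⟨?_, ?_, ?_⟩
    · intro 𝔓 h𝔓 σ hσ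
      obtain ⟨e1, e2⟩ := hI v hv 𝔓 h𝔓 σ hσ
      refine Units.ext ?_
      rw [hs' σ, Units.val_one]
      have : d σ = 1 := by
        ext i
        fin_cases i
        · exact e1
        · exact e2
      rw [this]
      exact Matrix.diagonal_one
    · intro 𝔓 h𝔓 σ hσ
      exact glFinOne_eq_one_of_det_eq_one (hI v hv 𝔓 h𝔓 σ hσ).1
    · intro 𝔓 h𝔓 σ hσ
      exact glFinOne_eq_one_of_det_eq_one (hI v hv 𝔓 h𝔓 σ hσ).2
  · intro v P hP 𝔓 h𝔓 σ hσ
    rw [hcharS]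
    exact hP 𝔓 h𝔓 σ hσ
  · intro g
    change FramedRep.toRepresentation s g (Pi.single 0 1) = _
    rw [FramedRep.apply_single_of_diagonal_two s d hs' g 0, hd0]
  · intro g
    change FramedRep.toRepresentation s g (Pi.single 1 1) = _
    rw [FramedRep.apply_single_of_diagonal_two s d hs' g 1, hd1]

end Galois

end Literature.NumberTheory.GaloisRepresentations

/-! ### The automorphic side: compatible representations of rank two -/

namespace Literature.NumberTheory.Automorphic

open GaloisRepresentations

section Compatible

variable {K : Type} [Field K] [NumberField K] {hcpt : isCompact_glFiniteIntegralLevel 2 K}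
  {ℓ : ℕ} [Fact ℓ.Prime]

/-- The places of a number field not above `ℓ` are cofinite (Mathlib `Ideal.finite_factors`).
[folklore] -/
theorem eventually_natCast_notMem_asIdeal (K : Type) [Field K] [NumberField K] (ℓ : ℕ)
    [Fact ℓ.Prime] :
    ∀ᶠ v : HeightOneSpectrum (𝓞 K) in cofinite, ((ℓ : ℕ) : 𝓞 K) ∉ v.asIdeal := by
  have hne : Ideal.span {((ℓ : ℕ) : 𝓞 K)} ≠ ⊥ := by
    rw [Ne, Ideal.span_singleton_eq_bot]
    exact_mod_cast (Fact.out : ℓ.Prime).ne_zero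
  refine Filter.mem_of_superset (Ideal.finite_factors hne).compl_mem_cofinite ?_
  intro v hv hmem
  exact hv (Ideal.dvd_span_singleton.2 hmem)

/-- **The semisimplification of a reducible compatible `r` is compatible, semisimple and
reducible, and its two characters carry the twisted Satake parameters.**  Let `π = W / W'` be an
automorphic representation datum of `GL₂(𝔸_K)`, `ι : ℚ̄_ℓ ≃+* ℂ`, and `r : Γ_K →ₜ* GL₂(ℚ̄_ℓ)`
compatible with `π` at every `v ∤ ℓ` (`IsGaloisCompatibleAt`) and NOT irreducible.  Then the
characters `τ₁, τ₂` and the semisimplification `s = τ₁ ⊕ τ₂` of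
`FramedGaloisRep.exists_semisimplification_two` satisfy: `s` is semisimple, not irreducible,
compatible with `π` at every `v ∤ ℓ` (both compatibility shapes of the tree); `τ₁`, `τ₂` occur on
`s`-stable lines; `charpoly s(g) = (X - τ₁ g)(X - τ₂ g)`; and at every `v ∤ ℓ` where `π` has
Satake parameter `α`, both `τ_i` are unramified and for every arithmetic Frobenius `σ` at a prime
above `v`, `{τ₁(σ), τ₂(σ)} = {ι⁻¹((√q_v a)⁻¹) : a ∈ α}` as multisets (the roots of
`arithFrobPolyOfSatake ι q_v 2 α`, `roots_arithFrobPolyOfSatake`) — the rank-two case of "the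
characters `χ_i` of `ρ_π^{ss} ≅ χ₁ ⊕ χ₂` have Frobenius values the Hecke eigenvalue data of `π`".
[folklore] -/
theorem exists_semisimple_compatible_of_not_isIrreducible
    (π : AutomorphicRepData (AutomorphyDatum.gl 2 K hcpt)) (ι : PadicAlgCl ℓ ≃+* ℂ)
    (r : FramedGaloisRep K (PadicAlgCl ℓ) 2)
    (hr : ∀ v : HeightOneSpectrum (𝓞 K), ((ℓ : ℕ) : 𝓞 K) ∉ v.asIdeal →
      IsGaloisCompatibleAt π ι r v)
    (hirr : ¬ r.toGaloisRep.IsIrreducible) :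
    ∃ (τ₁ τ₂ : FramedGaloisRep K (PadicAlgCl ℓ) 1) (s : FramedGaloisRep K (PadicAlgCl ℓ) 2),
      s.toGaloisRep.IsSemisimple ∧ ¬ s.toGaloisRep.IsIrreducible ∧
      (∀ v : HeightOneSpectrum (𝓞 K), ((ℓ : ℕ) : 𝓞 K) ∉ v.asIdeal →
        IsGaloisCompatibleAt π ι s v) ∧
      (∀ (v : HeightOneSpectrum (𝓞 K)) (α : Multiset ℂ), π.HasSatakeParamAt v α →
        ((ℓ : ℕ) : 𝓞 K) ∉ v.asIdeal →
          s.IsUnramifiedAt v ∧ s.HasFrobCharpolyAt v (arithFrobPolyOfSatake ι v.residueCard 2 α)) ∧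
      (∃ x : Fin 2 → PadicAlgCl ℓ, x ≠ 0 ∧ ∀ g : absoluteGaloisGroup K, s.toGaloisRep g x =
        ((Matrix.GeneralLinearGroup.det (τ₁ g) : (PadicAlgCl ℓ)ˣ) : PadicAlgCl ℓ) • x) ∧
      (∃ x : Fin 2 → PadicAlgCl ℓ, x ≠ 0 ∧ ∀ g : absoluteGaloisGroup K, s.toGaloisRep g x =
        ((Matrix.GeneralLinearGroup.det (τ₂ g) : (PadicAlgCl ℓ)ˣ) : PadicAlgCl ℓ) • x) ∧
      (∀ g, FramedRep.charpoly s g =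
        (X - C ((Matrix.GeneralLinearGroup.det (τ₁ g) : (PadicAlgCl ℓ)ˣ) : PadicAlgCl ℓ)) *
          (X - C ((Matrix.GeneralLinearGroup.det (τ₂ g) : (PadicAlgCl ℓ)ˣ) : PadicAlgCl ℓ))) ∧
      ∀ (v : HeightOneSpectrum (𝓞 K)) (α : Multiset ℂ), π.HasSatakeParamAt v α →
        ((ℓ : ℕ) : 𝓞 K) ∉ v.asIdeal →
          τ₁.IsUnramifiedAt v ∧ τ₂.IsUnramifiedAt v ∧
          ∀ 𝔓 ∈ v.primesAbove, ∀ σ : absoluteGaloisGroup K, IsArithFrobAt (𝓞 K) σ 𝔓 →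
            ({((Matrix.GeneralLinearGroup.det (τ₁ σ) : (PadicAlgCl ℓ)ˣ) : PadicAlgCl ℓ),
                ((Matrix.GeneralLinearGroup.det (τ₂ σ) : (PadicAlgCl ℓ)ˣ) : PadicAlgCl ℓ)} :
                Multiset (PadicAlgCl ℓ)) =
              α.map fun a => ι.symm ((((Real.sqrt (v.residueCard : ℝ)) : ℝ) : ℂ) * a)⁻¹ := by
  obtain ⟨τ₁, τ₂, s, x, hx0, -, hs, hss, hsirr, hcharS, hchar12, hunr, hfrob, he0, he1⟩ :=
    r.exists_semisimplification_two hirr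
  -- compatibility of `s`
  have hsc : ∀ (v : HeightOneSpectrum (𝓞 K)) (α : Multiset ℂ), π.HasSatakeParamAt v α →
      ((ℓ : ℕ) : 𝓞 K) ∉ v.asIdeal →
        s.IsUnramifiedAt v ∧ s.HasFrobCharpolyAt v (arithFrobPolyOfSatake ι v.residueCard 2 α) := by
    intro v α hα hv
    obtain ⟨h1, h2⟩ := hr v hv α hα
    exact ⟨(hunr v h1).1, hfrob v _ h2⟩
  have hcharτ : ∀ g, FramedRep.charpoly s g =
      (X - C ((Matrix.GeneralLinearGroup.det (τ₁ g) : (PadicAlgCl ℓ)ˣ) : PadicAlgCl ℓ)) *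
        (X - C ((Matrix.GeneralLinearGroup.det (τ₂ g) : (PadicAlgCl ℓ)ˣ) : PadicAlgCl ℓ)) := by
    intro g
    rw [hcharS g, ← hchar12 g, FramedGaloisRep.charpoly_eq_X_sub_C_det,
      FramedGaloisRep.charpoly_eq_X_sub_C_det]
  refine ⟨τ₁, τ₂, s, hss, hsirr, fun v hv α hα => hsc v α hα hv, hsc,
    ⟨Pi.single 0 1, by simp, he0⟩, ⟨Pi.single 1 1, by simp, he1⟩, hcharτ, ?_⟩
  intro v α hα hv
  obtain ⟨h1, h2⟩ := hr v hv α hα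
  refine ⟨(hunr v h1).2.1, (hunr v h1).2.2, fun 𝔓 h𝔓 σ hσ => ?_⟩
  set d₁ : PadicAlgCl ℓ := ((Matrix.GeneralLinearGroup.det (τ₁ σ) : (PadicAlgCl ℓ)ˣ) : PadicAlgCl ℓ)
  set d₂ : PadicAlgCl ℓ := ((Matrix.GeneralLinearGroup.det (τ₂ σ) : (PadicAlgCl ℓ)ˣ) : PadicAlgCl ℓ)
  have hP : arithFrobPolyOfSatake ι v.residueCard 2 α = (X - C d₁) * (X - C d₂) := by
    rw [← hcharτ σ, ← hfrob v _ h2 𝔓 h𝔓 σ hσ]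
  have hne : (X - C d₁) * (X - C d₂) ≠ 0 := mul_ne_zero (X_sub_C_ne_zero d₁) (X_sub_C_ne_zero d₂)
  have hroots := congrArg Polynomial.roots hP
  rw [roots_arithFrobPolyOfSatake, roots_mul hne, roots_X_sub_C, roots_X_sub_C] at hroots
  rw [Multiset.insert_eq_cons, ← Multiset.singleton_add, ← hroots]
  refine Multiset.map_congr rfl fun a _ => ?_
  norm_num

end Compatible

/-! ### The named fact reduces to semisimple `r` -/

section Reduction

/-- **`galoisRep_GL2_totallyReal_irreducible` follows from its restriction to semisimple `r`**:
if every continuous SEMISIMPLE `r : Γ_K →ₜ* GL₂(ℚ̄_ℓ)` compatible with the regular algebraic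
cuspidal `π` at every `v ∤ ℓ` is irreducible, then so is every compatible `r` — a reducible
compatible `r` has a reducible, semisimple, compatible semisimplification
(`exists_semisimple_compatible_of_not_isIrreducible`).  This is the remark of the module
docstring of `HilbertModularGaloisRep` ("a representation whose semisimplification is
irreducible is itself irreducible"), proved. [folklore] -/
theorem galoisRep_GL2_totallyReal_irreducible_of_semisimple
    (h : ∀ {K : Type} [Field K] [NumberField K] (hcpt : isCompact_glFiniteIntegralLevel 2 K),
      IsTotallyReal K →
      ∀ (π : CuspidalAutomorphicRepData 2 K hcpt), π.1.IsRegularAlgebraic →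
        ∀ (ℓ : ℕ) [Fact ℓ.Prime] (ι : PadicAlgCl ℓ ≃+* ℂ)
          (r : FramedGaloisRep K (PadicAlgCl ℓ) 2), r.toGaloisRep.IsSemisimple →
          (∀ v : HeightOneSpectrum (𝓞 K), ((ℓ : ℕ) : 𝓞 K) ∉ v.asIdeal →
            IsGaloisCompatibleAt π.1 ι r v) →
            r.toGaloisRep.IsIrreducible) :
    galoisRep_GL2_totallyReal_irreducible := by
  intro K _ _ hcpt hK π hπ ℓ _ ι r hr
  by_contra hirr
  obtain ⟨τ₁, τ₂, s, hss, hsirr, hsc, -⟩ :=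
    exists_semisimple_compatible_of_not_isIrreducible π.1 ι r hr hirr
  exact hsirr (h hcpt hK π hπ ℓ ι s hss hsc)

/-- **The named fact is equivalent to its restriction to semisimple `r`.** [folklore] -/
theorem galoisRep_GL2_totallyReal_irreducible_iff_semisimple :
    galoisRep_GL2_totallyReal_irreducible ↔
      ∀ {K : Type} [Field K] [NumberField K] (hcpt : isCompact_glFiniteIntegralLevel 2 K),
        IsTotallyReal K →
        ∀ (π : CuspidalAutomorphicRepData 2 K hcpt), π.1.IsRegularAlgebraic →
          ∀ (ℓ : ℕ) [Fact ℓ.Prime] (ι : PadicAlgCl ℓ ≃+* ℂ)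
            (r : FramedGaloisRep K (PadicAlgCl ℓ) 2), r.toGaloisRep.IsSemisimple →
            (∀ v : HeightOneSpectrum (𝓞 K), ((ℓ : ℕ) : 𝓞 K) ∉ v.asIdeal →
              IsGaloisCompatibleAt π.1 ι r v) →
              r.toGaloisRep.IsIrreducible :=
  ⟨fun h _ _ _ hcpt hK π hπ ℓ _ ι r _ hr => h hcpt hK π hπ ℓ ι r hr,
    galoisRep_GL2_totallyReal_irreducible_of_semisimple⟩

/-- **The named fact in the phrasing of the `GL₃` fact `isIrreducible_galoisRep_gl3_totallyReal`
(Böckle–Hui) and of the route `ReducibleSelfDual`**: irreducibility of every SEMISIMPLE `r` with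
the unramified compatibility of lang.S27 (`∀ v α, HasSatakeParamAt v α → v ∤ ℓ → unramified ∧
Frobenius characteristic polynomial`).  The two compatibility clauses differ only by the order of
their hypotheses. [folklore] -/
theorem galoisRep_GL2_totallyReal_irreducible_iff_satakeCompatible :
    galoisRep_GL2_totallyReal_irreducible ↔
      ∀ (K : Type) [Field K] [NumberField K], IsTotallyReal K →
        ∀ (hcpt : isCompact_glFiniteIntegralLevel 2 K) (π : CuspidalAutomorphicRepData 2 K hcpt),
          π.1.IsRegularAlgebraic → ∀ (ℓ : ℕ) [Fact ℓ.Prime] (ι : PadicAlgCl ℓ ≃+* ℂ)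
            (r : FramedGaloisRep K (PadicAlgCl ℓ) 2), r.toGaloisRep.IsSemisimple →
            (∀ (v : HeightOneSpectrum (𝓞 K)) (α : Multiset ℂ), π.1.HasSatakeParamAt v α →
                ((ℓ : ℕ) : 𝓞 K) ∉ v.asIdeal →
                  r.IsUnramifiedAt v ∧
                    r.HasFrobCharpolyAt v (arithFrobPolyOfSatake ι v.residueCard 2 α)) →
            r.toGaloisRep.IsIrreducible := by
  rw [galoisRep_GL2_totallyReal_irreducible_iff_semisimple]
  constructor
  · intro h K _ _ hK hcpt π hπ ℓ _ ι r hss hr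
    exact h hcpt hK π hπ ℓ ι r hss fun v hv α hα => hr v α hα hv
  · intro h K _ _ hcpt hK π hπ ℓ _ ι r hss hr
    exact h K hK hcpt π hπ ℓ ι r hss fun v α hα hv => hr v hv α hα

end Reduction

/-! ### Assembly of the fact from the two printed inputs -/

section Assembly

/-- **The irreducibility theorem assembled from the two inputs of its printed proof** (Skinner
2009, Remark p. 257: "If `ρ_π ≅ χ₁ ⊕ χ₂`, then each `χ_i` … is the Galois representation
associated to an algebraic Hecke character `ψ_i` of `F` (cf. [Se], esp. III, 2.3–2.4).  It then
follows that `L(π ⊗ ψ₂⁻¹, s − 1/2) = L(ψ₁/ψ₂, s) ζ_F(s)` … But this implies that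
`L(π ⊗ ψ₂⁻¹, s)` has a pole at `s = 1`, contradicting the cuspidality of `π`").  Granting
* (`hdict`, the dictionary "characters of `ρ_π^{ss}` are algebraic Hecke characters") for `K`
  totally real, `π` regular algebraic cuspidal on `GL₂(𝔸_K)`, `ℓ`, `ι` and a SEMISIMPLE `r`
  with the unramified compatibility of lang.S27, every character `τ` occurring on an `r`-stable
  line is the `ι`-avatar of an algebraic Hecke character `χ`: at all but finitely many `v`, `χ`
  and `τ` are unramified and `τ(Frob_v^{arith}) = ι⁻¹(χ(ϖ_v))⁻¹` — in print: Hodge–Tate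
  (Skinner Thm. 1, §2.4.1) + Serre 1968 Ch. III §2.3–2.4; in the tree this is the `n = 2`,
  totally real case of the route item `AbelianSummandIsHecke` (Böckle–Hui Thm. 1.1 =
  `GaloisRepresentations.exists_heckeCharacter_of_weaklyDivides` + `E`-rationality, see
  `abelianSummandIsHecke_GL2_totallyReal_of_weaklyDivides_of_rational`), and
* (`hJS`, the analytic half) for such `π` and algebraic Hecke characters `χ₁, χ₂` it is NOT the
  case that at all but finitely many `v` the `χ_i` are unramified and every Satake parameter `α`
  of `π` at `v` has `{√q_v a : a ∈ α} = {χ₁(ϖ_v), χ₂(ϖ_v)}` (i.e. `π_v ≅ π(χ₁|·|^{1/2}, χ₂|·|^{1/2})`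
  for almost all `v`: a cuspidal `π` is not nearly equivalent to an isobaric sum of two Hecke
  characters — the pole of `L(ψ₁/ψ₂, s) ζ_F(s)` at `s = 1` against the entire `L(π ⊗ ψ₂⁻¹, s)`;
  Jacquet–Shalika 1981 II, Thm. 4.4),
the named fact `galoisRep_GL2_totallyReal_irreducible` follows: reduce to semisimple `r`
(`galoisRep_GL2_totallyReal_irreducible_of_semisimple`); a reducible one is `τ₁ ⊕ τ₂`
(`exists_semisimple_compatible_of_not_isIrreducible`); `hdict` makes `τ_i` the avatar of `χ_i`;
reading the Frobenius characteristic polynomial at one Frobenius above each of the cofinitely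
many good places (`exists_isArithFrobAt_of_mem_primesAbove_holds`) gives the Satake identity that
`hJS` forbids.  Neither input is proved in the tree; this theorem fixes their Lean phrasing and
checks the logic of the printed proof (no new named fact, D-0026).
[cite: Skinner2009, §2.4.2 Remark (p. 257)] [cite: JacquetShalikaAJM1981II, Thm. 4.4] -/
theorem galoisRep_GL2_totallyReal_irreducible_of_abelianSummandIsHecke_of_not_eisenstein
    (hdict : ∀ {K : Type} [Field K] [NumberField K] (hcpt : isCompact_glFiniteIntegralLevel 2 K),
      IsTotallyReal K → ∀ (π : CuspidalAutomorphicRepData 2 K hcpt), π.1.IsRegularAlgebraic →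
      ∀ (ℓ : ℕ) [Fact ℓ.Prime] (ι : PadicAlgCl ℓ ≃+* ℂ) (r : FramedGaloisRep K (PadicAlgCl ℓ) 2),
      r.toGaloisRep.IsSemisimple →
      (∀ (v : HeightOneSpectrum (𝓞 K)) (α : Multiset ℂ), π.1.HasSatakeParamAt v α →
          ((ℓ : ℕ) : 𝓞 K) ∉ v.asIdeal →
            r.IsUnramifiedAt v ∧ r.HasFrobCharpolyAt v (arithFrobPolyOfSatake ι v.residueCard 2 α)) →
      ∀ (τ : FramedGaloisRep K (PadicAlgCl ℓ) 1),
      (∃ x : Fin 2 → PadicAlgCl ℓ, x ≠ 0 ∧ ∀ g : absoluteGaloisGroup K,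
          r.toGaloisRep g x =
            ((Matrix.GeneralLinearGroup.det (τ g) : (PadicAlgCl ℓ)ˣ) : PadicAlgCl ℓ) • x) →
      ∃ χ : HeckeCharacter K, χ.IsAlgebraic ∧
        ∀ᶠ v : HeightOneSpectrum (𝓞 K) in cofinite, χ.IsUnramifiedAt v ∧ τ.IsUnramifiedAt v ∧
          τ.HasFrobCharpolyAt v (X - C (ι.symm (χ.valueAtUniformizer v)⁻¹)))
    (hJS : ∀ {K : Type} [Field K] [NumberField K] (hcpt : isCompact_glFiniteIntegralLevel 2 K),
      IsTotallyReal K → ∀ (π : CuspidalAutomorphicRepData 2 K hcpt), π.1.IsRegularAlgebraic →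
      ∀ (χ₁ χ₂ : HeckeCharacter K), χ₁.IsAlgebraic → χ₂.IsAlgebraic →
      ¬ ∀ᶠ v : HeightOneSpectrum (𝓞 K) in cofinite,
          χ₁.IsUnramifiedAt v ∧ χ₂.IsUnramifiedAt v ∧
          ∀ α : Multiset ℂ, π.1.HasSatakeParamAt v α →
            α.map (fun a => (((Real.sqrt (v.residueCard : ℝ)) : ℝ) : ℂ) * a) =
              ({χ₁.valueAtUniformizer v, χ₂.valueAtUniformizer v} : Multiset ℂ)) :
    galoisRep_GL2_totallyReal_irreducible := by
  refine galoisRep_GL2_totallyReal_irreducible_of_semisimple ?_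
  intro K _ _ hcpt hK π hπ ℓ _ ι r _ hr
  by_contra hirr
  obtain ⟨τ₁, τ₂, s, hss, -, -, hsc, hx₁, hx₂, -, hsat⟩ :=
    exists_semisimple_compatible_of_not_isIrreducible π.1 ι r hr hirr
  obtain ⟨χ₁, hχ₁a, hχ₁⟩ := hdict hcpt hK π hπ ℓ ι s hss hsc τ₁ hx₁
  obtain ⟨χ₂, hχ₂a, hχ₂⟩ := hdict hcpt hK π hπ ℓ ι s hss hsc τ₂ hx₂
  refine hJS hcpt hK π hπ χ₁ χ₂ hχ₁a hχ₂a ?_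
  filter_upwards [hχ₁, hχ₂, eventually_natCast_notMem_asIdeal K ℓ] with v h₁ h₂ hvℓ
  refine ⟨h₁.1, h₂.1, fun α hα => ?_⟩
  obtain ⟨-, -, hroots⟩ := hsat v α hα hvℓ
  obtain ⟨𝔓, h𝔓⟩ := v.primesAbove_nonempty
  obtain ⟨σ, hσ⟩ :=
    IsDedekindDomain.HeightOneSpectrum.exists_isArithFrobAt_of_mem_primesAbove_holds (v := v) h𝔓
  -- the Frobenius values of `τ_i` are `ι⁻¹(χ_i(ϖ_v))⁻¹`
  have e₁ : ((Matrix.GeneralLinearGroup.det (τ₁ σ) : (PadicAlgCl ℓ)ˣ) : PadicAlgCl ℓ) =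
      ι.symm (χ₁.valueAtUniformizer v)⁻¹ := by
    have h := (FramedGaloisRep.charpoly_eq_X_sub_C_det τ₁ σ).symm.trans (h₁.2.2 𝔓 h𝔓 σ hσ)
    rwa [sub_right_inj, C_inj] at h
  have e₂ : ((Matrix.GeneralLinearGroup.det (τ₂ σ) : (PadicAlgCl ℓ)ˣ) : PadicAlgCl ℓ) =
      ι.symm (χ₂.valueAtUniformizer v)⁻¹ := by
    have h := (FramedGaloisRep.charpoly_eq_X_sub_C_det τ₂ σ).symm.trans (h₂.2.2 𝔓 h𝔓 σ hσ)
    rwa [sub_right_inj, C_inj] at h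
  have hm := hroots 𝔓 h𝔓 σ hσ
  rw [e₁, e₂] at hm
  have hm' := congrArg (Multiset.map fun z : PadicAlgCl ℓ => (ι z)⁻¹) hm
  simp only [Multiset.insert_eq_cons, Multiset.map_cons, Multiset.map_singleton, Multiset.map_map,
    Function.comp_def, RingEquiv.apply_symm_apply, inv_inv, mul_inv_rev] at hm'
  rw [Multiset.insert_eq_cons, hm']

/-- **The dictionary input from Böckle–Hui's Theorem 1.1 and `E`-rationality.**  Granting the
in-tree named fact `GaloisRepresentations.exists_heckeCharacter_of_weaklyDivides` (Böckle–Hui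
2025, Thm. 1.1, in its Hecke-character form) and the `E`-rationality of every semisimple `r`
compatible with a regular algebraic cuspidal `π` on `GL₂` over a totally real field (Shimura 1978
/ Clozel 1990 Thm. 3.13: the Hecke eigenvalues of `π` lie in a number field `E`, whence the
Frobenius characteristic polynomials of `r` have coefficients in `ι⁻¹(E)`), every character on an
`r`-stable line is the `ι`-avatar of an algebraic Hecke character
(`GaloisRepresentations.exists_heckeCharacter_of_stableLine`).  This is the hypothesis `hdict` of
`galoisRep_GL2_totallyReal_irreducible_of_abelianSummandIsHecke_of_not_eisenstein`, i.e. the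
`n = 2`, totally real case of the route item `AbelianSummandIsHecke`.
[cite: BockleHui2025, Theorem 1.1 and §3.2.1] -/
theorem abelianSummandIsHecke_GL2_totallyReal_of_weaklyDivides_of_rational
    (hBH : GaloisRepresentations.exists_heckeCharacter_of_weaklyDivides)
    (hrat : ∀ {K : Type} [Field K] [NumberField K] (hcpt : isCompact_glFiniteIntegralLevel 2 K),
      IsTotallyReal K → ∀ (π : CuspidalAutomorphicRepData 2 K hcpt), π.1.IsRegularAlgebraic →
      ∀ (ℓ : ℕ) [Fact ℓ.Prime] (ι : PadicAlgCl ℓ ≃+* ℂ) (r : FramedGaloisRep K (PadicAlgCl ℓ) 2),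
      r.toGaloisRep.IsSemisimple →
      (∀ (v : HeightOneSpectrum (𝓞 K)) (α : Multiset ℂ), π.1.HasSatakeParamAt v α →
          ((ℓ : ℕ) : 𝓞 K) ∉ v.asIdeal →
            r.IsUnramifiedAt v ∧ r.HasFrobCharpolyAt v (arithFrobPolyOfSatake ι v.residueCard 2 α)) →
      ∃ (E : Type) (_ : Field E) (_ : NumberField E) (e : E →+* PadicAlgCl ℓ), r.IsRationalOver e) :
    ∀ {K : Type} [Field K] [NumberField K] (hcpt : isCompact_glFiniteIntegralLevel 2 K),
      IsTotallyReal K → ∀ (π : CuspidalAutomorphicRepData 2 K hcpt), π.1.IsRegularAlgebraic →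
      ∀ (ℓ : ℕ) [Fact ℓ.Prime] (ι : PadicAlgCl ℓ ≃+* ℂ) (r : FramedGaloisRep K (PadicAlgCl ℓ) 2),
      r.toGaloisRep.IsSemisimple →
      (∀ (v : HeightOneSpectrum (𝓞 K)) (α : Multiset ℂ), π.1.HasSatakeParamAt v α →
          ((ℓ : ℕ) : 𝓞 K) ∉ v.asIdeal →
            r.IsUnramifiedAt v ∧ r.HasFrobCharpolyAt v (arithFrobPolyOfSatake ι v.residueCard 2 α)) →
      ∀ (τ : FramedGaloisRep K (PadicAlgCl ℓ) 1),
      (∃ x : Fin 2 → PadicAlgCl ℓ, x ≠ 0 ∧ ∀ g : absoluteGaloisGroup K,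
          r.toGaloisRep g x =
            ((Matrix.GeneralLinearGroup.det (τ g) : (PadicAlgCl ℓ)ˣ) : PadicAlgCl ℓ) • x) →
      ∃ χ : HeckeCharacter K, χ.IsAlgebraic ∧
        ∀ᶠ v : HeightOneSpectrum (𝓞 K) in cofinite, χ.IsUnramifiedAt v ∧ τ.IsUnramifiedAt v ∧
          τ.HasFrobCharpolyAt v (X - C (ι.symm (χ.valueAtUniformizer v)⁻¹)) := by
  intro K _ _ hcpt hK π hπ ℓ _ ι r hss hr τ hx
  obtain ⟨E, _, _, e, hre⟩ := hrat hcpt hK π hπ ℓ ι r hss hr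
  exact exists_heckeCharacter_of_stableLine hBH e hss hre τ hx ι

/-- **The named fact from Böckle–Hui's Theorem 1.1, `E`-rationality and the analytic half**:
`galoisRep_GL2_totallyReal_irreducible_of_abelianSummandIsHecke_of_not_eisenstein` with its
dictionary input supplied by `abelianSummandIsHecke_GL2_totallyReal_of_weaklyDivides_of_rational`.
Of the three hypotheses only the first is a named fact of the tree (unproved); the other two are
the printed inputs "the Hecke eigenvalues of a Hilbert eigenform are algebraic (Shimura)" and
"a cuspidal `π` on `GL₂` is not nearly equivalent to an isobaric sum of two Hecke characters
(Jacquet–Shalika)", whose Lean phrasing this theorem fixes.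
[cite: Skinner2009, §2.4.2 Remark (p. 257)] [cite: BockleHui2025, Theorem 1.1 and §3.2.1] -/
theorem galoisRep_GL2_totallyReal_irreducible_of_weaklyDivides_of_rational_of_not_eisenstein
    (hBH : GaloisRepresentations.exists_heckeCharacter_of_weaklyDivides)
    (hrat : ∀ {K : Type} [Field K] [NumberField K] (hcpt : isCompact_glFiniteIntegralLevel 2 K),
      IsTotallyReal K → ∀ (π : CuspidalAutomorphicRepData 2 K hcpt), π.1.IsRegularAlgebraic →
      ∀ (ℓ : ℕ) [Fact ℓ.Prime] (ι : PadicAlgCl ℓ ≃+* ℂ) (r : FramedGaloisRep K (PadicAlgCl ℓ) 2),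
      r.toGaloisRep.IsSemisimple →
      (∀ (v : HeightOneSpectrum (𝓞 K)) (α : Multiset ℂ), π.1.HasSatakeParamAt v α →
          ((ℓ : ℕ) : 𝓞 K) ∉ v.asIdeal →
            r.IsUnramifiedAt v ∧ r.HasFrobCharpolyAt v (arithFrobPolyOfSatake ι v.residueCard 2 α)) →
      ∃ (E : Type) (_ : Field E) (_ : NumberField E) (e : E →+* PadicAlgCl ℓ), r.IsRationalOver e)
    (hJS : ∀ {K : Type} [Field K] [NumberField K] (hcpt : isCompact_glFiniteIntegralLevel 2 K),
      IsTotallyReal K → ∀ (π : CuspidalAutomorphicRepData 2 K hcpt), π.1.IsRegularAlgebraic →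
      ∀ (χ₁ χ₂ : HeckeCharacter K), χ₁.IsAlgebraic → χ₂.IsAlgebraic →
      ¬ ∀ᶠ v : HeightOneSpectrum (𝓞 K) in cofinite,
          χ₁.IsUnramifiedAt v ∧ χ₂.IsUnramifiedAt v ∧
          ∀ α : Multiset ℂ, π.1.HasSatakeParamAt v α →
            α.map (fun a => (((Real.sqrt (v.residueCard : ℝ)) : ℝ) : ℂ) * a) =
              ({χ₁.valueAtUniformizer v, χ₂.valueAtUniformizer v} : Multiset ℂ)) :
    galoisRep_GL2_totallyReal_irreducible :=
  galoisRep_GL2_totallyReal_irreducible_of_abelianSummandIsHecke_of_not_eisenstein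
    (abelianSummandIsHecke_GL2_totallyReal_of_weaklyDivides_of_rational hBH hrat) hJS

end Assembly

/-! ### `E`-rationality of compatible `r` from the rationality of the Hecke eigenvalues -/

section Rational

variable {K : Type} [Field K] [NumberField K] {hcpt : isCompact_glFiniteIntegralLevel 2 K}
  {ℓ : ℕ} [Fact ℓ.Prime]

/-- **`E`-rationality of a compatible rank-two `r` from the rationality of the unramified Hecke
eigenvalues** (Böckle–Hui §3.1: "there exist a number field `E` and a finite subset `S ⊂ Σ_K`
containing the ramified primes of `π` such that the Satake parameters of
`π_v ⊗ |det|_v^{(1-n)/2}` are defined over `E` for all `v ∈ Σ_K ∖ S`. … Then the semisimple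
`ℓ`-adic representation … `ρ_{π,ι}` … is `E`-rational and unramified outside `S`").  Rank two:
if at all but finitely many places the Hecke eigenvalues `t_{v,1} = √q_v (a + b)` and
`t_{v,2} = a b` of `π` (`heckeEigenvalueOf 2 v {a, b} i`, the eigenvalues of
`AutomorphicRepData.HasSatakeParamAt`) lie in the subfield `E ⊆ ℂ`, then every `r` with the
unramified compatibility of lang.S27 is `E`-rational for `ι⁻¹|_E : E → ℚ̄_ℓ`: its Frobenius
characteristic polynomial at a good place is
`(X - ι⁻¹((√q a)⁻¹))(X - ι⁻¹((√q b)⁻¹)) = X² - ι⁻¹(t_{v,1}/(q t_{v,2})) X + ι⁻¹(1/(q t_{v,2}))`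
(with the obvious modifications when `a b = 0`), a polynomial over `ι⁻¹(E)`.  The good places are
cofinite by Flath (`AutomorphicRepData.hasSatakeParamAt_cofinite_holds`) and
`eventually_natCast_notMem_asIdeal`. [cite: BockleHui2025, §3.1] -/
theorem isRationalOver_of_heckeEigenvalue_mem_two
    (π : AutomorphicRepData (AutomorphyDatum.gl 2 K hcpt)) (ι : PadicAlgCl ℓ ≃+* ℂ)
    (r : FramedGaloisRep K (PadicAlgCl ℓ) 2)
    (hr : ∀ (v : HeightOneSpectrum (𝓞 K)) (α : Multiset ℂ), π.HasSatakeParamAt v α →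
      ((ℓ : ℕ) : 𝓞 K) ∉ v.asIdeal →
        r.IsUnramifiedAt v ∧ r.HasFrobCharpolyAt v (arithFrobPolyOfSatake ι v.residueCard 2 α))
    (E : Subfield ℂ)
    (hE : ∀ᶠ v : HeightOneSpectrum (𝓞 K) in cofinite, ∀ α : Multiset ℂ,
      π.HasSatakeParamAt v α → ∀ i ≤ 2, heckeEigenvalueOf 2 v α i ∈ E) :
    r.IsRationalOver ((ι.symm : ℂ ≃+* PadicAlgCl ℓ).toRingHom.comp E.subtype) := by
  have hcof : ∀ᶠ v : HeightOneSpectrum (𝓞 K) in cofinite, π.IsUnramifiedAt v :=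
    π.hasSatakeParamAt_cofinite_holds
  filter_upwards [hcof, hE, eventually_natCast_notMem_asIdeal K ℓ] with v hv hEv hvℓ
  obtain ⟨α, hα⟩ := hv
  obtain ⟨hunr, hP⟩ := hr v α hα hvℓ
  refine ⟨hunr, ?_⟩
  obtain ⟨a, b, rfl⟩ := Multiset.card_eq_two.1 hα.card_eq
  set q : ℕ := v.residueCard with hq
  set sq : ℂ := ((Real.sqrt (q : ℝ) : ℝ) : ℂ) with hsq
  have hsq2 : sq * sq = (q : ℂ) := by
    rw [hsq, ← Complex.ofReal_mul, Real.mul_self_sqrt (Nat.cast_nonneg _), Complex.ofReal_natCast]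
  have hsq0 : sq ≠ 0 := by
    rw [hsq, Complex.ofReal_ne_zero]
    exact Real.sqrt_ne_zero'.2 (by exact_mod_cast lt_trans zero_lt_one v.one_lt_residueCard)
  -- the two Hecke eigenvalues and `q` lie in `E`
  have ht1 : sq * (a + b) ∈ E := by
    have h := hEv _ hα 1 (by norm_num)
    simpa [heckeEigenvalueOf, Multiset.insert_eq_cons] using h
  have ht2 : a * b ∈ E := by
    have h := hEv _ hα 2 le_rfl
    simpa [heckeEigenvalueOf, Multiset.insert_eq_cons] using h
  have hqE : (q : ℂ) ∈ E := natCast_mem E q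
  -- the coefficients of the Frobenius polynomial
  set u : ℂ := (sq * a)⁻¹ with hu
  set w : ℂ := (sq * b)⁻¹ with hw
  have hprod : u * w ∈ E := by
    have e : u * w = ((q : ℂ) * (a * b))⁻¹ := by
      rw [hu, hw, ← mul_inv, ← hsq2]
      ring_nf
    rw [e]
    exact inv_mem (mul_mem hqE ht2)
  have hsum : u + w ∈ E := by
    by_cases ha : a = 0
    · have hu0 : u = 0 := by rw [hu, ha, mul_zero, inv_zero]
      by_cases hb : b = 0
      · have hw0 : w = 0 := by rw [hw, hb, mul_zero, inv_zero]
        rw [hu0, hw0, add_zero]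
        exact zero_mem E
      · have h1 : sq * b ∈ E := by simpa [ha] using ht1
        rw [hu0, zero_add, hw]
        exact inv_mem h1
    by_cases hb : b = 0
    · have hw0 : w = 0 := by rw [hw, hb, mul_zero, inv_zero]
      have h1 : sq * a ∈ E := by simpa [hb] using ht1
      rw [hw0, add_zero, hu]
      exact inv_mem h1
    · have e : u + w = sq * (a + b) * ((q : ℂ) * (a * b))⁻¹ := by
        rw [hu, hw, ← hsq2]
        field_simp
        ring
      rw [e]
      exact mul_mem ht1 (inv_mem (mul_mem hqE ht2))
  refine ⟨X ^ 2 - C (⟨u + w, hsum⟩ : E) * X + C (⟨u * w, hprod⟩ : E), ?_⟩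
  intro 𝔓 h𝔓 σ hσ
  rw [hP 𝔓 h𝔓 σ hσ]
  simp only [arithFrobPolyOfSatake, Multiset.insert_eq_cons, Multiset.map_cons,
    Multiset.map_singleton, Multiset.prod_cons, Multiset.prod_singleton, Polynomial.map_add,
    Polynomial.map_sub, Polynomial.map_mul, Polynomial.map_pow, map_X, map_C,
    RingHom.coe_comp, Function.comp_apply, RingEquiv.toRingHom_eq_coe, RingEquiv.coe_toRingHom,
    Subfield.coe_subtype, map_add, map_mul]
  have h21 : (2 - 1 : ℕ) = 1 := rfl
  rw [h21, pow_one, ← hsq, ← hu, ← hw]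
  ring

/-- **The `E`-rationality input of the dictionary from the rationality of the Hecke eigenvalues.**
If for every regular algebraic cuspidal `π` on `GL₂(𝔸_K)` over a totally real `K` there is a
number field `E ⊆ ℂ` containing the unramified Hecke eigenvalues at all but finitely many places
("the Satake parameters of `π_v ⊗ |det|_v^{-1/2}` are defined over `E`", Böckle–Hui §3.1 after
Clozel 1990, Thm. 3.13 / Shimura), then every `r` compatible with such a `π` is `E`-rational for a
number field `E` (the hypothesis `hrat` of
`abelianSummandIsHecke_GL2_totallyReal_of_weaklyDivides_of_rational`), by
`isRationalOver_of_heckeEigenvalue_mem_two`. [cite: BockleHui2025, §3.1]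
[cite: Clozel1990, §3.1 and Thm. 3.13] -/
theorem rational_GL2_totallyReal_of_heckeEigenvalue_mem
    (hShi : ∀ {K : Type} [Field K] [NumberField K] (hcpt : isCompact_glFiniteIntegralLevel 2 K),
      IsTotallyReal K → ∀ (π : CuspidalAutomorphicRepData 2 K hcpt), π.1.IsRegularAlgebraic →
      ∃ E : Subfield ℂ, FiniteDimensional ℚ E ∧
        ∀ᶠ v : HeightOneSpectrum (𝓞 K) in cofinite, ∀ α : Multiset ℂ,
          π.1.HasSatakeParamAt v α → ∀ i ≤ 2, heckeEigenvalueOf 2 v α i ∈ E) :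
    ∀ {K : Type} [Field K] [NumberField K] (hcpt : isCompact_glFiniteIntegralLevel 2 K),
      IsTotallyReal K → ∀ (π : CuspidalAutomorphicRepData 2 K hcpt), π.1.IsRegularAlgebraic →
      ∀ (ℓ : ℕ) [Fact ℓ.Prime] (ι : PadicAlgCl ℓ ≃+* ℂ) (r : FramedGaloisRep K (PadicAlgCl ℓ) 2),
      r.toGaloisRep.IsSemisimple →
      (∀ (v : HeightOneSpectrum (𝓞 K)) (α : Multiset ℂ), π.1.HasSatakeParamAt v α →
          ((ℓ : ℕ) : 𝓞 K) ∉ v.asIdeal →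
            r.IsUnramifiedAt v ∧ r.HasFrobCharpolyAt v (arithFrobPolyOfSatake ι v.residueCard 2 α)) →
      ∃ (E : Type) (_ : Field E) (_ : NumberField E) (e : E →+* PadicAlgCl ℓ), r.IsRationalOver e := by
  intro K _ _ hcpt hK π hπ ℓ _ ι r _ hr
  obtain ⟨E, hfd, hE⟩ := hShi hcpt hK π hπ
  haveI : FiniteDimensional ℚ E := hfd
  haveI : NumberField E := NumberField.mk
  exact ⟨E, inferInstance, inferInstance, _, isRationalOver_of_heckeEigenvalue_mem_two π.1 ι r hr E hE⟩

/-- **The named fact from Böckle–Hui's Theorem 1.1, the rationality of the Hecke eigenvalues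
and the analytic half**:
`galoisRep_GL2_totallyReal_irreducible_of_weaklyDivides_of_rational_of_not_eisenstein` with the
`E`-rationality of `r` reduced to the printed statement about `π` ("the Satake parameters of
`π_v ⊗ |det|_v^{-1/2}` are defined over a number field `E`", Böckle–Hui §3.1; Clozel 1990,
Thm. 3.13; for Hilbert eigenforms, Shimura) by `rational_GL2_totallyReal_of_heckeEigenvalue_mem`.
[cite: Skinner2009, §2.4.2 Remark (p. 257)] [cite: BockleHui2025, Theorem 1.1, §3.1 and §3.2.1] -/
theorem galoisRep_GL2_totallyReal_irreducible_of_weaklyDivides_of_heckeEigenvalue_mem_of_not_eisenstein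
    (hBH : GaloisRepresentations.exists_heckeCharacter_of_weaklyDivides)
    (hShi : ∀ {K : Type} [Field K] [NumberField K] (hcpt : isCompact_glFiniteIntegralLevel 2 K),
      IsTotallyReal K → ∀ (π : CuspidalAutomorphicRepData 2 K hcpt), π.1.IsRegularAlgebraic →
      ∃ E : Subfield ℂ, FiniteDimensional ℚ E ∧
        ∀ᶠ v : HeightOneSpectrum (𝓞 K) in cofinite, ∀ α : Multiset ℂ,
          π.1.HasSatakeParamAt v α → ∀ i ≤ 2, heckeEigenvalueOf 2 v α i ∈ E)
    (hJS : ∀ {K : Type} [Field K] [NumberField K] (hcpt : isCompact_glFiniteIntegralLevel 2 K),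
      IsTotallyReal K → ∀ (π : CuspidalAutomorphicRepData 2 K hcpt), π.1.IsRegularAlgebraic →
      ∀ (χ₁ χ₂ : HeckeCharacter K), χ₁.IsAlgebraic → χ₂.IsAlgebraic →
      ¬ ∀ᶠ v : HeightOneSpectrum (𝓞 K) in cofinite,
          χ₁.IsUnramifiedAt v ∧ χ₂.IsUnramifiedAt v ∧
          ∀ α : Multiset ℂ, π.1.HasSatakeParamAt v α →
            α.map (fun a => (((Real.sqrt (v.residueCard : ℝ)) : ℝ) : ℂ) * a) =
              ({χ₁.valueAtUniformizer v, χ₂.valueAtUniformizer v} : Multiset ℂ)) :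
    galoisRep_GL2_totallyReal_irreducible :=
  galoisRep_GL2_totallyReal_irreducible_of_weaklyDivides_of_rational_of_not_eisenstein hBH
    (rational_GL2_totallyReal_of_heckeEigenvalue_mem hShi) hJS

end Rational

end Literature.NumberTheory.Automorphic
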